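import Summits.QuantumFields.BalabanUV.Beta.FP.TowerHN2RowMixed

/-!
# `BalabanUV.Beta.FP.TowerHN2RowMixedWard` — road «FP», binder row D1, ROUTE T (β1), (E4d²) PART 3b (v2): **THE RESIDUAL GAUGE ROW (J-Λ₂′) OF PART 3a IS A THEOREM OF THREE
# SINGLE-TABLE ROWS — the mixed table's fine pure-gauge (Ward) row (K2b), the source display (J-ΛS) of the order-1 Λ-words, ONE scalar lock — and a residual (J-R₂) that is
# trivial when (K2b) is a pure commutator**; v5's second-order H-row `hHN₂` per box and for every label pair then holds at the road's data modulo the scalar rows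
# `hcE₂ hcM₂ hL`, the Ward rows (J-X₂) ∕ (K2b), (J-ΛS) and (J-R₂) — the cut (K2b)∘(K1′)∘lock of an2's J-NOTE-12 §3 (journal l.67877 A-2, l.67886 A-3, l.67898 S-2; road l.67881, l.67899)

WHY.  PART 3a `TowerHN2RowMixed` reduced PART 2's displayed remainder row (J-Λ₂) to the mixed lock `hcM₂` and ONE lump (J-Λ₂′)
`c•([E_a, Λ₁(r•e_{a′})] + [E_{a′}, Λ₁(r•e_a)]) = (cM₂·r) • Σ_bΣ_β ((Dλ_a)_b·Ŝ_{a′} β + (Dλ_{a′})_b·Ŝ_a β) • ℳ̂₂ b β` — a JOINT identity between the conjugated order-1 Λ-words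
and the mixed table.  It factors (J-NOTE-12 §3): write the right side as `(cM₂·r) • Σ_β (Ŝ_{a′} β • 𝒢_{λ_a}(β) + Ŝ_a β • 𝒢_{λ_{a′}}(β))` with `𝒢_λ(β) := Σ_b (Dλ)_b • ℳ̂₂ b β` the
mixed table's FINE PURE-GAUGE ROW; then (J-Λ₂′) follows from
  (K2b)  `𝒢_λ(β) = κ₂ • [E_λ, Ĉ_β] + Σ_s λ s • Rs s β` — gauge covariance of the constraint-Hessian family read through the mixed table (a Ward row of ONE table; the
         site-remainder family `Rs` is DISPLAYED: `0` for a pure commutator, an1's remainder of `Beta/CombMixedT2SiteLetter.divV_mixedT2_site_of_lock` otherwise — an2 S-2),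
  (J-ΛS) `Λ₁(r•e_a) = cΛS • Σ_β Ŝ_a β • Ĉ_β` — along the pinned sources the order-1 Λ-words are the same constraint-Hessian family superposed with the chart's
         multiplier column (= (J-Λ♮) «`Λ₁(r•e_a) = −r·cΛ·Σ_β ψ′_a(β) • Ĉ_β`» ∘ (K1′) «`Ŝ_a = κ₁ • ψ′_a`», the column form of K1; by value R-AN2-59-K1 T3 ∕ R-AN2-69-K2L T2),
  (L)    `c·cΛS = cM₂·r·κ₂` — ONE scalar lock (the Λ-side twin of `hcB ∕ hcE₂ ∕ hcM₂`),
  (J-R₂) `Σ_β (Ŝ_{a′} β • Σ_s λ_a s • Rs s β + Ŝ_a β • Σ_s λ_{a′} s • Rs s β) = 0` — the remainder's `Ŝ`-contraction symmetrised in the two sources (TRIVIAL at `Rs = 0`;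
         otherwise exactly what R-AN2-69-K2L-ADD1's T3 overlap line measures),
by finite-sum algebra (§0 `commutator_pair_of_wardRow`: `[E,·]` is linear, the lock matches the coefficients, `module` termwise).  `Ĉ_β` is WRITTEN OUT in both rows
(an2 g70 W-1 (ii), journal l.67927: the two rows must name the SAME table for the cut to carry content): the periodised COMPOSITE constraint Hessian
`(perF T (dper T ((tabsComp (n+2) …).H β.2 ↑β.1)))|ff` — no copy sum, no even half (`dper T` of a coarse-indexed covariant first-order table is the sum over the coarse-period
copies; at depth 1 `compH_one` makes it an1's `symHessFFAt`, an2 PART 26's `Ĥ_β`).  Kernel status at depth 1 (an2 g70 PART 25∕26 `CombMixedT2EvenSiteLetter ∕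
CombMixedT2EvenPeriodised.torus_M2even_pureGauge_fst_fun`): (K2b) holds with `κ₂ = −wM2_j`, `Rs = 0`; the composite depths (`tabsComp (n+2)`, v5's instances) need the
mixed table's Ward induction over `compMixKer_succ` — the row's, not claimed; hence `Rs` stays displayed and §2's pure corollary is what v6 calls when `Rs = 0` is in hand.
By-value status (zero weight): R-AN2-69-K2L (Engine C, `ttrl/requests.jsonl` l.4482 ∕ l.4484; TIER V GO l.67927) tests (K2b) (T1 ∕ T1″), (K1′) (T2) and the strong form
of (J-Λ₂′) (T3).
WHAT ([folklore] `Matrix`∕`Finset` bookkeeping BY NAME; no `def`, no `def … : Prop`, nothing cited, 0 sorry; PART 3a's letters `lv Λ₁ M₂ cM₂ r` + `cΛS κ₂ Rs` and the four rows):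
§0 `commutator_pair_of_wardRow` (generic); §1 **`hJΛ2'_of_wardRow`** — PART 3a's lump (J-Λ₂′) at `(a, a′)` AS A THEOREM of `hΛS hK2b hL hR₂` — exactly the `hJΛ₂'` slot of
PART 3a `hJΛ2_of_mixedLock_of_mixedGauge`, which in turn is the `hJΛ₂` slot of PART 2 `hHN2_of_locks_of_junctions ∕ hHN2_family_of_locks_of_junctions`: consumers (v6) feed
the chain IN PLACE, at `Rs := 0` for the pure-commutator reading (an2 g70 A-1: v5's right side carries the EVEN half; depth-1 kernel `CombMixedT2EvenPeriodised`, `κ₂ = −wM2_j`).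
v2 NOTE: the per-box ∕ family restatements of v5's `hHN₂` (v1.2's `hHN2_of_locks_of_wardRow`, `…_family_…`, `…_pureWardRow`) are NOT in this file — the gate's `dedup.landed`
rule keys a theorem on its conclusion and that conclusion is PART 2's to state (probe dry-runs 01:10Z ∕ 01:13Z, journal); nothing of content is lost: they were one-line feeds.
WHAT THIS IS NOT: not the rows' inhabitation nor the scalars' VALUES (junction conditions on the literal ∕ the free pins, displayed; K2L decides only by-value
instantiability at depth 1, float64, zero weight); not the kernel route to (K2b) (lift (T2-M₂) through PART 22∕23's packaging — an2's, J-NOTE-12 §3-ADD) nor to (J-ΛS)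
(`TowerHN1Row` + the torus split of `V̂N|ff` + (K1′)); not v6; not `a2`; nothing of Bałaban's asserted, valued or discharged; 0 estimates; 0∕4 row-D1 binders (hW, hR,
D1Tel, D1Rep); ROOT M‴ p325680 ∕ P5c ∕ D6 untouched; NOT (C1), NOT (T-ID), NOT D1, NEVER «G-an2-4 closed», NOT BetaPertH, NOT continuum, NOT Clay.

HONEST DEPENDENCY (page 1, mandatory): continuum YM on T⁴ ⇐ BetaPertH ∧ nine spine estimates (0/9 proved); BetaPertH ⇐ (D1) ∧ (D4) ∧ CAP+tail;
G-an2-4 gates asym, D1 and NE2/3/4.  HONEST FRAMING (cell contract, verbatim): «discharging `BetaPertH` makes Bałaban's UV stability UNCONDITIONAL —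
a real constructive-QFT result; it is NOT the continuum limit and NOT the Clay problem.»  ABSOLUTE RULE (cell charter, verbatim): «No internally-minted
statement may enter as a cited fact. Every hypothesis is either kernel-proved in this package or a verbatim quotation of a PUBLISHED theorem with page
reference. The manuscript(s) under audit are NOT citable for their own disputed steps — they are the thing under adjudication; programme-internal
(2001/route/tribunal) claims are never citable.»  Road «FP» OWNER, b2b-balaban-beta-d1-p3 gen 46, 2026-08-28.  No existing file touched.
-/

noncomputable section

open scoped BigOperators

namespace Summit.QuantumFields.BalabanUV.Beta.FP.TowerHN2RowMixedWard

open Finset Matrix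
open Literature.MathematicalPhysics.QuantumFieldTheory
open Literature.MathematicalPhysics.QuantumFieldTheory.Balaban1983to89
open Literature.MathematicalPhysics.QuantumFieldTheory.Balaban1983to89.Beta
open B4TorusKernel.MultiPeriod (translate)
open B5Prop11Plancherel (fine)
open B6Lemma24Torus (pbox)
open AffineAveraging (Site box toSite)
open AveragingContoursRooted (ctr ctrOff)
open OneStepResolventKernel (Fib)
open StepJetData (wilsonA)
open WilsonBiStencil (wilsonW₂)
open BalabanStepW2 (M2Of)
open Summit.QuantumFields.BalabanUV.Beta.TameKernelCalculus (trK)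
open Summit.QuantumFields.BalabanUV.Beta.BorderedHessian (sgnK)
open Summit.QuantumFields.BalabanUV.Beta.SymShiftedSpread (bhKStepSh)
open Summit.QuantumFields.BalabanUV.Beta.DshAn1 (Dsh)
open Summit.QuantumFields.BalabanUV.Beta.AxialDressingRooted (one_le_of_neZero)
open Summit.QuantumFields.BalabanUV.Beta.CompositeOneShotJets (tabsComp)
open Summit.QuantumFields.BalabanUV.Beta.CompositeOneShotJetData (Roots Pins AN WN)
open Summit.QuantumFields.BalabanUV.Beta.FP.KernelPeriodisationFib (Idx perF)
open Summit.QuantumFields.BalabanUV.Beta.FP.KernelPeriodisationFibLoc (dper)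
open Summit.QuantumFields.BalabanUV.Beta.FP.TorusGaugeCovariance (tgrad)
open Summit.QuantumFields.BalabanUV.Beta.FP.TorusGaugeCovariancePairing (wrapPt)
open Summit.QuantumFields.BalabanUV.Beta.FP.TorusCompositeObjects (towerTorus)
open Summit.QuantumFields.BalabanUV.Beta.FP.TowerHN1Row (map_smul_of_linear)
open Summit.QuantumFields.BalabanUV.Beta.FP.TowerQN1RowJet (direction_add_exact_eq_smul_col)



section Algebra

/-- [folklore] **the commutator pair from a Ward row, a source display and one lock**: if `Σ_b d_b • M b β = κ₂•[E, C β] + Rm β` and `Σ_b d′_b • M b β = κ₂•[E′, C β] + Rm′ β`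
(Ward rows with remainders), `Λ = cS • Σ_β S β • C β`, `Λ′ = cS • Σ_β S′ β • C β` (source displays), `c·cS = t·κ₂` (lock) and the remainders' contraction vanishes
(`Σ_β (S′ β • Rm β + S β • Rm′ β) = 0`), then `c•([E,Λ′] + [E′,Λ]) = t • Σ_bΣ_β (d_b S′_β + d′_b S_β) • M b β` (`[E,X] := E X − X E`; finite sums, `module` termwise). -/
theorem commutator_pair_of_wardRow {ι ι' : Type*} [Fintype ι] [Fintype ι'] (E E' : Matrix ι ι ℝ) (C : ι' → Matrix ι ι ℝ) (S S' : ι' → ℝ)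
    (d d' : ι → ℝ) (Mx : ι → ι' → Matrix ι ι ℝ) (Rm Rm' : ι' → Matrix ι ι ℝ) (κ₂ : ℝ)
    (hK : ∀ β, ∑ b, d b • Mx b β = κ₂ • (E * C β - C β * E) + Rm β) (hK' : ∀ β, ∑ b, d' b • Mx b β = κ₂ • (E' * C β - C β * E') + Rm' β)
    (Λ Λ' : Matrix ι ι ℝ) (cS : ℝ) (hΛ : Λ = cS • ∑ β, S β • C β) (hΛ' : Λ' = cS • ∑ β, S' β • C β)
    (c t : ℝ) (hlock : c * cS = t * κ₂) (hR : ∑ β, (S' β • Rm β + S β • Rm' β) = 0) :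
    c • (E * Λ' - Λ' * E + (E' * Λ - Λ * E')) = t • ∑ b, ∑ β, (d b * S' β + d' b * S β) • Mx b β := by
  have step : c • (E * Λ' - Λ' * E + (E' * Λ - Λ * E')) + t • ∑ β, (S' β • Rm β + S β • Rm' β)
      = t • ∑ β, (S' β • ∑ b, d b • Mx b β + S β • ∑ b, d' b • Mx b β) := by
    simp only [hK, hK', hΛ, hΛ', Matrix.mul_smul, Matrix.smul_mul, Finset.mul_sum, Finset.sum_mul, Finset.smul_sum, smul_add, smul_sub,
      ← Finset.sum_add_distrib, ← Finset.sum_sub_distrib]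
    refine Finset.sum_congr rfl fun β _ => ?_
    simp only [smul_smul, ← mul_assoc]
    rw [hlock]
    module
  rw [hR, smul_zero, add_zero] at step
  rw [step, Finset.sum_comm]
  refine congrArg _ (Finset.sum_congr rfl fun β _ => ?_)
  rw [Finset.smul_sum, Finset.smul_sum, ← Finset.sum_add_distrib]
  exact Finset.sum_congr rfl fun b _ => by module

end Algebra


/-! ## §1 The residual gauge row (J-Λ₂′) from (J-ΛS), (K2b), the lock and (J-R₂); the H-row per box -/

section Row

variable {Lc : ℕ} [NeZero Lc] (M : Fin (3 + 1) → ℕ) [∀ μ, NeZero (M μ)] (n : ℕ) (c : ℝ) (Pn : Pins)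
  {κ : Type*} [DecidableEq κ] (yN : κ → Site (3 + 1)) (μN : κ → Fin (3 + 1))
  -- PART 2 ∕ 3a's letters that the lump (J-Λ₂′) mentions: the tree-gauge read-out `lv`, the NAME `Λ₁` of the order-1 Λ-words (#7), the mixed table's NAME `M₂` (PART 3a's
  -- letter `hM₂` pins it for the consumer), the mixed weight `cM₂`, the pin factor `r`, the two sources
  (lv : (κ → ℝ) → (↥(pbox (towerTorus Lc (fine Lc M) (n + 1))) → ℝ))
  (Λ₁ : (κ → ℝ) → Matrix (↥(pbox (towerTorus Lc (fine Lc M) (n + 1))) × Fin (3 + 1)) (↥(pbox (towerTorus Lc (fine Lc M) (n + 1))) × Fin (3 + 1)) ℝ)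
  (M₂ : ↥(pbox (towerTorus Lc (fine Lc M) (n + 1))) × Fin (3 + 1) → ↥(pbox M) × Fin (3 + 1) → Matrix (↥(pbox (towerTorus Lc (fine Lc M) (n + 1))) × Fin (3 + 1)) (↥(pbox (towerTorus Lc (fine Lc M) (n + 1))) × Fin (3 + 1)) ℝ) (cM₂ : ℝ)
  (r : ℝ) (a a' : κ)
  -- (J-ΛS): THE ORDER-1 Λ-WORDS ALONG THE PINNED SOURCES are the torus constraint-Hessian family `Ĉ_β := (perF T (dper T ((tabsComp (n+2) …).H β.2 ↑β.1)))|ff`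
  -- (the periodised COMPOSITE constraint Hessian, written out — an2 g70 W-1 (ii)) superposed with the chart's multiplier column `Ŝ_a` — J-NOTE-12 §3's (J-Λ♮)∘(K1′)
  (cΛS κ₂ : ℝ)
  (hΛS : ∀ a₀ : κ, Λ₁ (r • (Pi.single a₀ (1 : ℝ) : κ → ℝ)) = cΛS • ∑ β : ↥(pbox M) × Fin (3 + 1),
      perF (towerTorus Lc (fine Lc M) (n + 1)) (AN (Roots.ctr Lc) (n + 1)) (wrapPt (towerTorus Lc (fine Lc M) (n + 1)) (((Lc ^ (n + 1 + 1) : ℕ) : ℤ) • (β.1 : Site (3 + 1))), Sum.inr β.2) (wrapPt (towerTorus Lc (fine Lc M) (n + 1)) (((Lc ^ (n + 1 + 1) : ℕ) : ℤ) • yN a₀), Sum.inr (μN a₀))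
        • (perF (towerTorus Lc (fine Lc M) (n + 1)) (dper (towerTorus Lc (fine Lc M) (n + 1)) ((tabsComp (n + 1 + 1) (one_le_of_neZero Lc) (Roots.ctr Lc).hr (Pn.cM (n + 1 + 1))).H β.2 (β.1 : Site (3 + 1))))).submatrix (fun b : ↥(pbox (towerTorus Lc (fine Lc M) (n + 1))) × Fin (3 + 1) => ((b.1, Sum.inl b.2) : Idx (towerTorus Lc (fine Lc M) (n + 1)) (Fib 3))) (fun b : ↥(pbox (towerTorus Lc (fine Lc M) (n + 1))) × Fin (3 + 1) => ((b.1, Sum.inl b.2) : Idx (towerTorus Lc (fine Lc M) (n + 1)) (Fib 3))))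
  -- (K2b): THE MIXED TABLE's FINE PURE-GAUGE (WARD) ROW — the generator's commutator with `Ĉ_β` plus a displayed site-remainder family `Rs` (`0` in the pure case;
  -- intended otherwise: an1's remainder of `Beta/CombMixedT2SiteLetter.divV_mixedT2_site_of_lock`, periodised) — for EVERY gauge function `lam` on the torus sites
  (Rs : ↥(pbox (towerTorus Lc (fine Lc M) (n + 1))) → ↥(pbox M) × Fin (3 + 1) → Matrix (↥(pbox (towerTorus Lc (fine Lc M) (n + 1))) × Fin (3 + 1)) (↥(pbox (towerTorus Lc (fine Lc M) (n + 1))) × Fin (3 + 1)) ℝ)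
  (hK2b : ∀ (lam : ↥(pbox (towerTorus Lc (fine Lc M) (n + 1))) → ℝ) (β : ↥(pbox M) × Fin (3 + 1)),
      ∑ b : ↥(pbox (towerTorus Lc (fine Lc M) (n + 1))) × Fin (3 + 1), (∑ s : ↥(pbox (towerTorus Lc (fine Lc M) (n + 1))), tgrad (towerTorus Lc (fine Lc M) (n + 1)) (b.1, Sum.inl b.2) s * lam s) • M₂ b β
        = κ₂ • (Matrix.diagonal (fun b : ↥(pbox (towerTorus Lc (fine Lc M) (n + 1))) × Fin (3 + 1) => lam b.1) * (perF (towerTorus Lc (fine Lc M) (n + 1)) (dper (towerTorus Lc (fine Lc M) (n + 1)) ((tabsComp (n + 1 + 1) (one_le_of_neZero Lc) (Roots.ctr Lc).hr (Pn.cM (n + 1 + 1))).H β.2 (β.1 : Site (3 + 1))))).submatrix (fun b : ↥(pbox (towerTorus Lc (fine Lc M) (n + 1))) × Fin (3 + 1) => ((b.1, Sum.inl b.2) : Idx (towerTorus Lc (fine Lc M) (n + 1)) (Fib 3))) (fun b : ↥(pbox (towerTorus Lc (fine Lc M) (n + 1))) × Fin (3 + 1) => ((b.1, Sum.inl b.2)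 : Idx (towerTorus Lc (fine Lc M) (n + 1)) (Fib 3)))
          - (perF (towerTorus Lc (fine Lc M) (n + 1)) (dper (towerTorus Lc (fine Lc M) (n + 1)) ((tabsComp (n + 1 + 1) (one_le_of_neZero Lc) (Roots.ctr Lc).hr (Pn.cM (n + 1 + 1))).H β.2 (β.1 : Site (3 + 1))))).submatrix (fun b : ↥(pbox (towerTorus Lc (fine Lc M) (n + 1))) × Fin (3 + 1) => ((b.1, Sum.inl b.2) : Idx (towerTorus Lc (fine Lc M) (n + 1)) (Fib 3))) (fun b : ↥(pbox (towerTorus Lc (fine Lc M) (n + 1))) × Fin (3 + 1) => ((b.1, Sum.inl b.2) : Idx (towerTorus Lc (fine Lc M) (n + 1)) (Fib 3))) * Matrix.diagonal (fun b : ↥(pbox (towerTorus Lc (fine Lc M) (n + 1))) × Fin (3 + 1) => lam b.1))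
          + ∑ s : ↥(pbox (towerTorus Lc (fine Lc M) (n + 1))), lam s • Rs s β)
  -- THE Λ-SIDE SCALAR LOCK (J-NOTE-12 §3 (L)) and THE RESIDUAL ROW (J-R₂) (the remainder's `Ŝ`-contraction, symmetrised in the two sources; trivial when `Rs = 0`)
  (hL : c * cΛS = cM₂ * r * κ₂)
  (hR₂ : ∑ β : ↥(pbox M) × Fin (3 + 1), (perF (towerTorus Lc (fine Lc M) (n + 1)) (AN (Roots.ctr Lc) (n + 1)) (wrapPt (towerTorus Lc (fine Lc M) (n + 1)) (((Lc ^ (n + 1 + 1) : ℕ) : ℤ) • (β.1 : Site (3 + 1))), Sum.inr β.2) (wrapPt (towerTorus Lc (fine Lc M) (n + 1)) (((Lc ^ (n + 1 + 1) : ℕ) : ℤ) • yN a'), Sum.inr (μN a')) • ∑ s : ↥(pbox (towerTorus Lc (fine Lc M) (n + 1))), lv (r • (Pi.single a (1 : ℝ) : κ → ℝ)) s • Rs s β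
        + perF (towerTorus Lc (fine Lc M) (n + 1)) (AN (Roots.ctr Lc) (n + 1)) (wrapPt (towerTorus Lc (fine Lc M) (n + 1)) (((Lc ^ (n + 1 + 1) : ℕ) : ℤ) • (β.1 : Site (3 + 1))), Sum.inr β.2) (wrapPt (towerTorus Lc (fine Lc M) (n + 1)) (((Lc ^ (n + 1 + 1) : ℕ) : ℤ) • yN a), Sum.inr (μN a)) • ∑ s : ↥(pbox (towerTorus Lc (fine Lc M) (n + 1))), lv (r • (Pi.single a' (1 : ℝ) : κ → ℝ)) s • Rs s β) = 0)

include hΛS hK2b hL hR₂ in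
/-- [folklore] **`hJΛ2'_of_wardRow` — PART 3a's DISPLAYED RESIDUAL GAUGE ROW (J-Λ₂′) AT `(a, a′)` IS A THEOREM OF (J-ΛS), (K2b), THE LOCK `hL` AND (J-R₂)**:
`c•([E_a, Λ₁(r•e_{a′})] + [E_{a′}, Λ₁(r•e_a)]) = (cM₂·r) • Σ_bΣ_β ((Dλ_a)_b·Ŝ_{a′} β + (Dλ_{a′})_b·Ŝ_a β) • ℳ̂₂ b β` (`λ_a := lv (r•e_a)`, `E_a := diagonal (λ_a ∘ pr)`,
`(Dλ)_b := Σ_s tgrad_b s·λ s`) — §0 `commutator_pair_of_wardRow` at the generators `E_a ∕ E_{a′}`, the Ward rows `hK2b λ_a ∕ hK2b λ_{a′}`, the displays `hΛS a ∕ hΛS a′`. -/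
theorem hJΛ2'_of_wardRow :
    c • (Matrix.diagonal (fun b : ↥(pbox (towerTorus Lc (fine Lc M) (n + 1))) × Fin (3 + 1) => lv (r • (Pi.single a (1 : ℝ) : κ → ℝ)) b.1) * Λ₁ (r • (Pi.single a' (1 : ℝ) : κ → ℝ))
              - Λ₁ (r • (Pi.single a' (1 : ℝ) : κ → ℝ)) * Matrix.diagonal (fun b : ↥(pbox (towerTorus Lc (fine Lc M) (n + 1))) × Fin (3 + 1) => lv (r • (Pi.single a (1 : ℝ) : κ → ℝ)) b.1)
              + (Matrix.diagonal (fun b : ↥(pbox (towerTorus Lc (fine Lc M) (n + 1))) × Fin (3 + 1) => lv (r • (Pi.single a' (1 : ℝ) : κ → ℝ)) b.1) * Λ₁ (r • (Pi.single a (1 : ℝ) : κ → ℝ))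
                - Λ₁ (r • (Pi.single a (1 : ℝ) : κ → ℝ)) * Matrix.diagonal (fun b : ↥(pbox (towerTorus Lc (fine Lc M) (n + 1))) × Fin (3 + 1) => lv (r • (Pi.single a' (1 : ℝ) : κ → ℝ)) b.1)))
      = (cM₂ * r) • ∑ b : ↥(pbox (towerTorus Lc (fine Lc M) (n + 1))) × Fin (3 + 1), ∑ β : ↥(pbox M) × Fin (3 + 1),
          ((∑ s : ↥(pbox (towerTorus Lc (fine Lc M) (n + 1))), tgrad (towerTorus Lc (fine Lc M) (n + 1)) (b.1, Sum.inl b.2) s * lv (r • (Pi.single a (1 : ℝ) : κ → ℝ)) s)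
              * perF (towerTorus Lc (fine Lc M) (n + 1)) (AN (Roots.ctr Lc) (n + 1)) (wrapPt (towerTorus Lc (fine Lc M) (n + 1)) (((Lc ^ (n + 1 + 1) : ℕ) : ℤ) • (β.1 : Site (3 + 1))), Sum.inr β.2)
              (wrapPt (towerTorus Lc (fine Lc M) (n + 1)) (((Lc ^ (n + 1 + 1) : ℕ) : ℤ) • yN a'), Sum.inr (μN a'))
            + (∑ s : ↥(pbox (towerTorus Lc (fine Lc M) (n + 1))), tgrad (towerTorus Lc (fine Lc M) (n + 1)) (b.1, Sum.inl b.2) s * lv (r • (Pi.single a' (1 : ℝ) : κ → ℝ)) s)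
              * perF (towerTorus Lc (fine Lc M) (n + 1)) (AN (Roots.ctr Lc) (n + 1)) (wrapPt (towerTorus Lc (fine Lc M) (n + 1)) (((Lc ^ (n + 1 + 1) : ℕ) : ℤ) • (β.1 : Site (3 + 1))), Sum.inr β.2)
              (wrapPt (towerTorus Lc (fine Lc M) (n + 1)) (((Lc ^ (n + 1 + 1) : ℕ) : ℤ) • yN a), Sum.inr (μN a))) • M₂ b β :=
  commutator_pair_of_wardRow
    (Matrix.diagonal (fun b : ↥(pbox (towerTorus Lc (fine Lc M) (n + 1))) × Fin (3 + 1) => lv (r • (Pi.single a (1 : ℝ) : κ → ℝ)) b.1)) (Matrix.diagonal (fun b : ↥(pbox (towerTorus Lc (fine Lc M) (n + 1))) × Fin (3 + 1) => lv (r • (Pi.single a' (1 : ℝ) : κ → ℝ)) b.1))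
    (fun β : ↥(pbox M) × Fin (3 + 1) => (perF (towerTorus Lc (fine Lc M) (n + 1)) (dper (towerTorus Lc (fine Lc M) (n + 1)) ((tabsComp (n + 1 + 1) (one_le_of_neZero Lc) (Roots.ctr Lc).hr (Pn.cM (n + 1 + 1))).H β.2 (β.1 : Site (3 + 1))))).submatrix (fun b : ↥(pbox (towerTorus Lc (fine Lc M) (n + 1))) × Fin (3 + 1) => ((b.1, Sum.inl b.2) : Idx (towerTorus Lc (fine Lc M) (n + 1)) (Fib 3))) (fun b : ↥(pbox (towerTorus Lc (fine Lc M) (n + 1))) × Fin (3 + 1) => ((b.1, Sum.inl b.2) : Idx (towerTorus Lc (fine Lc M) (n + 1)) (Fib 3))))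
    (fun β : ↥(pbox M) × Fin (3 + 1) => perF (towerTorus Lc (fine Lc M) (n + 1)) (AN (Roots.ctr Lc) (n + 1)) (wrapPt (towerTorus Lc (fine Lc M) (n + 1)) (((Lc ^ (n + 1 + 1) : ℕ) : ℤ) • (β.1 : Site (3 + 1))), Sum.inr β.2) (wrapPt (towerTorus Lc (fine Lc M) (n + 1)) (((Lc ^ (n + 1 + 1) : ℕ) : ℤ) • yN a), Sum.inr (μN a)))
    (fun β : ↥(pbox M) × Fin (3 + 1) => perF (towerTorus Lc (fine Lc M) (n + 1)) (AN (Roots.ctr Lc) (n + 1)) (wrapPt (towerTorus Lc (fine Lc M) (n + 1)) (((Lc ^ (n + 1 + 1) : ℕ) : ℤ) • (β.1 : Site (3 + 1))), Sum.inr β.2) (wrapPt (towerTorus Lc (fine Lc M) (n + 1)) (((Lc ^ (n + 1 + 1) : ℕ) : ℤ) • yN a'), Sum.inr (μN a')))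
    (fun b : ↥(pbox (towerTorus Lc (fine Lc M) (n + 1))) × Fin (3 + 1) => ∑ s : ↥(pbox (towerTorus Lc (fine Lc M) (n + 1))), tgrad (towerTorus Lc (fine Lc M) (n + 1)) (b.1, Sum.inl b.2) s * lv (r • (Pi.single a (1 : ℝ) : κ → ℝ)) s)
    (fun b : ↥(pbox (towerTorus Lc (fine Lc M) (n + 1))) × Fin (3 + 1) => ∑ s : ↥(pbox (towerTorus Lc (fine Lc M) (n + 1))), tgrad (towerTorus Lc (fine Lc M) (n + 1)) (b.1, Sum.inl b.2) s * lv (r • (Pi.single a' (1 : ℝ) : κ → ℝ)) s) M₂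
    (fun β : ↥(pbox M) × Fin (3 + 1) => ∑ s : ↥(pbox (towerTorus Lc (fine Lc M) (n + 1))), lv (r • (Pi.single a (1 : ℝ) : κ → ℝ)) s • Rs s β) (fun β : ↥(pbox M) × Fin (3 + 1) => ∑ s : ↥(pbox (towerTorus Lc (fine Lc M) (n + 1))), lv (r • (Pi.single a' (1 : ℝ) : κ → ℝ)) s • Rs s β) κ₂
    (fun β => hK2b _ β) (fun β => hK2b _ β) (Λ₁ (r • (Pi.single a (1 : ℝ) : κ → ℝ))) (Λ₁ (r • (Pi.single a' (1 : ℝ) : κ → ℝ))) cΛS (hΛS a) (hΛS a') c (cM₂ * r) hL hR₂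

end Row

end Summit.QuantumFields.BalabanUV.Beta.FP.TowerHN2RowMixedWard

end
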